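import Literature.Analysis.FluidPDE.ChaeWolfRemovingDSSProofs
import Literature.Analysis.FluidPDE.PineauVicolRSSHolds
import Literature.Analysis.FluidPDE.NSLerayStrongLocalExistence
import Summits.NavierStokesRegularity.NavierStokesRegularity.Theorems.TypeICertificateLadderTargetRssCompactnessAnsatzSmooth
import Summits.NavierStokesRegularity.NavierStokesRegularity.Theorems.TypeICertificateLadderTargetRssCompactnessPressureCover
import Summits.NavierStokesRegularity.NavierStokesRegularity.Theorems.TypeICertificateLadderTargetRssCompactnessSymmetric
import HarnessLib

/-!
# Crux `Target` (stmt-NavierStokesRegularity-1217), line `killing-twisted-bernoulli-solitons`,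
  stub B5b window topology: the RSS-symmetric compactness limit is a classical solution

Support file (theorems only, `--supports stmt-NavierStokesRegularity-1217`), registered sub-goal
`rssCompact_limit_classical` of the c2 lead's programme "the Pineau–Vicol RSS Liouville property
is OPEN in the rotation speed `α` / the counterexample set is compact".

Setting. Chae–Wolf's indirect compactness argument (Comm. PDE 42 (2017), §3; tree
`ChaeWolf.exists_limit`, `PineauVicol2026.exists_limit_rss`) run along a sequence of Type-I
rotated self-similar (RSS) solutions with speeds `α_n → α₀` produces a field `v` on
`(−∞, −1/4] × ℝ³` which is continuous, obeys the Type-I bound `‖v(t,x)‖ ≤ C₀/(‖x‖ + √−t)`, is a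
bounded weak Navier–Stokes solution on `(−∞, −1/4)`, and is RSS-SYMMETRIC with speed `α₀`:
`v(t,x) = μ R(2α₀ log μ) v(μ²t, μ R(−2α₀ log μ) x)` for every `μ ≥ 1`. To contradict Liouville AT
`α₀` in Pineau–Vicol's class (classical on `[−1, 0)`, `C²` profile, the ansatz (1.7), the bound
(1.10)) this limit must be upgraded to a CLASSICAL solution on all of `t < 0`; that is what this
file does (`rssCompact_limit_classical`):

1. one slice `v(t₁)`, `t₁ < −1/4`, is smooth (KNSS 2009 §4, `KNSS2009_regularity_boundedWeak_window_holds`),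
   hence so is the profile `U₀ = v(−1)` (`rssCompact_profile_contDiff`: `v(−1)` is a
   rotation–dilation of `v(t₁)` by the symmetry);
2. the RSS ansatz field `w = pvAnsatz α₀ U₀` of the profile coincides with `v` on `t ≤ −1/4`
   (`rssCompact_eq_pvAnsatz_of_symmetric`, a neighbouring stub) and is jointly smooth on `t < 0`
   (`rssCompact_contDiffOn_pvAnsatz`, a neighbouring stub);
3. on every window `(a, b)`, `b ≤ −1/4`, the smooth bounded weak solution has a pressure
   (`rssCompact_window_classical`: Fabes–Jones–Rivière projection
   `integral_inner_momentum_eq_zero_of_slab_weak` + de Rham/Poincaré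
   `exists_isClassicalNSSolutionOn_of_forall_integral_inner_eq_zero`);
4. the Navier–Stokes scaling–rotation covariance and the EXACT invariance of the ansatz field
   under `(t,x) ↦ (μ²t, μR(−θ_μ)x)` (`PineauVicol2026.pvAnsatz_rss_eq_smul_rotZ`) transport the
   classical structure to the rescaled windows (`rssCompact_rescaled_classical`), which exhaust
   `t < 0`; the pressures patch (`rssCompact_exists_pressure_of_cover`, a neighbouring stub).

The Type-I bound of `w` with the same constant is Remark 1.2 of the source
(`norm_pvAnsatz_le_of_profile`).

## References

* D. Chae, J. Wolf, Comm. PDE 42 (2017) 1359–1374 = arXiv:1610.09464, §3. [ChaeWolf2017RemovingDSS]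
* B. Pineau, V. Vicol, arXiv:2607.09619 (2026), §1.2 (1.7)–(1.10), Remarks 1.2, 1.5, Thm. 1.4,
  footnote 13. [PineauVicol2026]
* G. Koch, N. Nadirashvili, G. Seregin, V. Šverák, Acta Math. 203 (2009), §4.
  [KochNadirashviliSereginSverak2009]
-/

noncomputable section

namespace Summit.NavierStokesRegularity.NavierStokesRegularity.Theorems

open MeasureTheory Set Function Filter Metric Real
open scoped Topology ENNReal NNReal ContDiff Laplacian
open Literature.Analysis.FluidPDE Literature.Analysis.FluidPDE.PineauVicol2026

/-! ### Step 1: the profile `v(−1)` of the limit is smooth -/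

/-- **One smooth slice (KNSS 2009, §4).** A continuous field on `(−∞, −1/4] × ℝ³` with a Type-I
bound which is a bounded weak Navier–Stokes solution on `(−∞, −1/4)` has a `C^∞` slice `v(t₁)`
at some `t₁ < −1/4` (the KNSS decomposition `v = U + b` on a window has smooth `U(τ)` and agrees
with the continuous `v(τ)` a.e., hence everywhere, at a.e. `τ`). Verbatim the first step of the
tree's `ChaeWolf.limit_eq_zero`. [cite: KochNadirashviliSereginSverak2009, §4 (4.10); ChaeWolf2017RemovingDSS, §3] -/
theorem rssCompact_exists_smooth_slice {C₀ : ℝ}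
    {v : ℝ → EuclideanSpace ℝ (Fin 3) → EuclideanSpace ℝ (Fin 3)} (hvc : Continuous (uncurry v))
    (hvI : ∀ t ≤ -(1 / 4 : ℝ), ∀ x, ‖v t x‖ ≤ C₀ / (‖x‖ + √(-t)))
    (hweak : IsBoundedWeakNSSolutionOn (Iio 0) isOpen_Iio 1 (fun t => v (t - 1 / 4))) :
    ∃ t₁ < -(1 / 4 : ℝ), ContDiff ℝ ∞ (v t₁) := by
  -- adapted from Literature/Analysis/FluidPDE/ChaeWolfRemovingDSSProofs.lean (limit_eq_zero, Step 1)
  have hC₀ : 0 ≤ C₀ := by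
    have h := hvI (-1) (by norm_num) 0
    rw [norm_zero, zero_add, neg_neg, Real.sqrt_one, div_one] at h
    exact (norm_nonneg _).trans h
  have hvb : ∀ t ≤ -(1 / 4 : ℝ), ∀ x, ‖v t x‖ ≤ 2 * C₀ := by
    intro t ht x
    refine (hvI t ht x).trans ?_
    have h12 : (1 / 2 : ℝ) ≤ √(-t) := (Real.le_sqrt' (by norm_num)).2 (by nlinarith)
    have hden : (1 / 2 : ℝ) ≤ ‖x‖ + √(-t) := by linarith [norm_nonneg x]
    calc C₀ / (‖x‖ + √(-t)) ≤ C₀ / (1 / 2) :=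
          div_le_div_of_nonneg_left hC₀ (by norm_num) hden
      _ = 2 * C₀ := by ring
  have hvslice : ∀ t, Continuous (v t) := fun t =>
    hvc.comp (continuous_const.prodMk continuous_id)
  obtain ⟨Cw, Lw, N, hwin⟩ :=
    KNSS2009_regularity_boundedWeak_window_holds (2 * C₀) 2 (by norm_num)
  have hw2 : IsBoundedWeakNSSolutionOn (Ioo 0 2) isOpen_Ioo 1
      (fun τ => v (τ + -2 - 1 / 4)) :=
    (hweak.mono (J := Ioo (-2) 0) isOpen_Ioo Ioo_subset_Iio_self).comp_add_right (-2)
      (J := Ioo 0 2) isOpen_Ioo fun τ => by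
        simp only [mem_Ioo]
        constructor <;> intro h <;> constructor <;> linarith [h.1, h.2]
  have hM : ∀ τ ∈ Ioo (0 : ℝ) 2, ∀ x, ‖v (τ + -2 - 1 / 4) x‖ ≤ 2 * C₀ := fun τ hτ x =>
    hvb _ (by linarith [hτ.2]) x
  obtain ⟨U, b, -, -, -, hae, hUs, -⟩ := hwin hw2 hM
  have hne : (ae ((volume : Measure ℝ).restrict (Ioo (0 : ℝ) 2))).NeBot := by
    rw [ae_neBot, Ne, Measure.restrict_eq_zero, Real.volume_Ioo]
    norm_num
  obtain ⟨τ₁, hτ₁, hτ₁m⟩ := (hae.and (ae_restrict_mem measurableSet_Ioo)).exists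
  refine ⟨τ₁ + -2 - 1 / 4, by linarith [hτ₁m.2], ?_⟩
  have hc2 : Continuous fun x => U τ₁ x + b τ₁ :=
    (hUs τ₁ hτ₁m).continuous.add continuous_const
  have heq : v (τ₁ + -2 - 1 / 4) = fun x => U τ₁ x + b τ₁ :=
    (Continuous.ae_eq_iff_eq volume (hvslice _) hc2).1 hτ₁
  rw [heq]
  exact (hUs τ₁ hτ₁m).add contDiff_const

/-- **The profile of an RSS-symmetric limit is smooth.** Under the hypotheses of
`rssCompact_exists_smooth_slice` plus the RSS symmetry with speed `α₀` (for all `μ ≥ 1` on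
`t ≤ −1/4`), the slice `v(−1)` is `C^∞`: by the symmetry (through
`rssCompact_eq_pvAnsatz_of_symmetric`) `v(−1) y = R(−θ) (r • v(t₁) (r • R(θ) y))`,
`r = √(−t₁)`, `θ = −α₀ log(−t₁)`, a rotation–dilation of the smooth slice. [cite: ChaeWolf2017RemovingDSS, §3; PineauVicol2026, §1.2 (1.7)] -/
theorem rssCompact_profile_contDiff {C₀ α₀ : ℝ}
    {v : ℝ → EuclideanSpace ℝ (Fin 3) → EuclideanSpace ℝ (Fin 3)} (hvc : Continuous (uncurry v))
    (hvI : ∀ t ≤ -(1 / 4 : ℝ), ∀ x, ‖v t x‖ ≤ C₀ / (‖x‖ + √(-t)))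
    (hweak : IsBoundedWeakNSSolutionOn (Iio 0) isOpen_Iio 1 (fun t => v (t - 1 / 4)))
    (hss : ∀ μ : ℝ, 1 ≤ μ → ∀ t ≤ -(1 / 4 : ℝ), ∀ x,
      v t x = μ • rotZ (α₀ * (2 * Real.log μ)) (v (μ ^ 2 * t) (μ • rotZ (-(α₀ * (2 * Real.log μ))) x))) :
    ContDiff ℝ ∞ (v (-1)) := by
  obtain ⟨t₁, ht₁, hsm₁⟩ := rssCompact_exists_smooth_slice hvc hvI hweak
  have h4 := rssCompact_eq_pvAnsatz_of_symmetric α₀ v hss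
  set r : ℝ := Real.sqrt (-t₁) with hr
  set θ : ℝ := α₀ * -Real.log (-t₁) with hθ
  have hr0 : 0 < r := Real.sqrt_pos.2 (by linarith)
  -- `v(−1) y = R(−θ) (r • v(t₁) (r • R(θ) y))`
  have hrepr : ∀ y, v (-1) y = rotZ (-θ) (r • v t₁ (r • rotZ θ y)) := by
    intro y
    have key := h4 t₁ ht₁.le (r • rotZ θ y)
    -- unfold the ansatz at `t₁`
    have e1 : (fun (z : EuclideanSpace ℝ (Fin 3)) (_ : ℝ) => v (-1) z) = fun z _ => v (-1) z := rfl
    simp only [pvAnsatz] at key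
    rw [← hr, ← hθ, smul_smul, inv_mul_cancel₀ hr0.ne', one_smul, ← rotZ_add, neg_add_cancel,
      rotZ_zero] at key
    -- `key : v t₁ (r • rotZ θ y) = r⁻¹ • rotZ θ (v (-1) y)`
    have h2 : r • v t₁ (r • rotZ θ y) = rotZ θ (v (-1) y) := by
      rw [key, smul_smul, mul_inv_cancel₀ hr0.ne', one_smul]
    rw [h2, ← rotZ_add, neg_add_cancel, rotZ_zero]
  have hfun : v (-1) = fun y => rotZ (-θ) (r • v t₁ (r • rotZ θ y)) := funext hrepr
  rw [hfun]
  have h1 : ContDiff ℝ ∞ fun y : EuclideanSpace ℝ (Fin 3) => r • rotZ θ y := by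
    have : (fun y : EuclideanSpace ℝ (Fin 3) => r • rotZ θ y) = fun y => r • rotZL θ y := rfl
    rw [this]
    exact (rotZL θ).contDiff.const_smul r
  have h2 : ContDiff ℝ ∞ fun y : EuclideanSpace ℝ (Fin 3) => r • v t₁ (r • rotZ θ y) :=
    (hsm₁.comp h1).const_smul r
  have h3 : (fun y => rotZ (-θ) (r • v t₁ (r • rotZ θ y))) =
      fun y => rotZL (-θ) (r • v t₁ (r • rotZ θ y)) := rfl
  rw [h3]
  exact (rotZL (-θ)).contDiff.comp h2

/-! ### Step 3: a pressure on every window before `−1/4` -/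

/-- **Windows.** Let `w` be jointly smooth on `t < 0`, agree with `v` on `t ≤ −1/4`, and let
`t ↦ v(t − 1/4)` be a bounded weak Navier–Stokes solution on `(−∞, 0)`. Then on every window
`(a, b)` with `b ≤ −1/4` there is a pressure making `(w, q)` a classical solution: shift the
window to `(0, b − a)`, project the weak identity of the smooth field onto solenoidal tests
(`integral_inner_momentum_eq_zero_of_slab_weak`), reconstruct the pressure
(`exists_isClassicalNSSolutionOn_of_forall_integral_inner_eq_zero`), shift back. The pattern of
Steps 3–4 of the tree's `ChaeWolf.limit_eq_zero`. [cite: KochNadirashviliSereginSverak2009, §4; ChaeWolf2017RemovingDSS, §3] -/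
theorem rssCompact_window_classical
    {v w : ℝ → EuclideanSpace ℝ (Fin 3) → EuclideanSpace ℝ (Fin 3)}
    (hwsm : ContDiffOn ℝ ∞ (uncurry w) (Iio (0 : ℝ) ×ˢ (univ : Set (EuclideanSpace ℝ (Fin 3)))))
    (h4 : ∀ t ≤ -(1 / 4 : ℝ), ∀ x, v t x = w t x)
    (hweak : IsBoundedWeakNSSolutionOn (Iio 0) isOpen_Iio 1 (fun t => v (t - 1 / 4)))
    {a b : ℝ} (hab : a < b) (hb : b ≤ -(1 / 4 : ℝ)) :
    ∃ q : ℝ → EuclideanSpace ℝ (Fin 3) → ℝ, IsClassicalNSSolutionOn (Ioo a b) 1 0 w q := by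
  set T : ℝ := b - a with hT
  have hT0 : 0 < T := by rw [hT]; linarith
  -- the shifted field `W τ = v (τ + a)` on `(0, T)`
  set W : ℝ → EuclideanSpace ℝ (Fin 3) → EuclideanSpace ℝ (Fin 3) := fun τ => v (τ + a) with hW
  have hWeq : ∀ τ ∈ Ioo (0 : ℝ) T, ∀ x, W τ x = w (τ + a) x := fun τ hτ x =>
    h4 (τ + a) (by rw [hT] at hτ; linarith [hτ.2]) x
  -- joint smoothness of `W` on the window (from that of `w`)
  have hwsm' : IsSmoothSpaceTimeOn (Iio 0) w := hwsm
  have hWsm : IsSmoothSpaceTimeOn (Ioo 0 T) W := by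
    have h1 := hwsm'.comp_add_right a
    have h2 : IsSmoothSpaceTimeOn (Ioo 0 T) (fun t => w (t + a)) :=
      h1.mono fun τ hτ => by
        simp only [mem_preimage, mem_Iio]
        rw [hT] at hτ; linarith [hτ.2]
    refine (h2 : ContDiffOn ℝ ∞ _ _).congr fun z hz => ?_
    obtain ⟨τ, x⟩ := z
    exact hWeq τ (mem_prod.1 hz).1 x
  -- the weak formulation on the window
  have hWweak : IsBoundedWeakNSSolutionOn (Ioo 0 T) isOpen_Ioo 1 W := by
    have e : ∀ t : ℝ, t + (a + 1 / 4) - 1 / 4 = t + a := fun t => by ring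
    have hsub : Ioo (a + 1 / 4) (b + 1 / 4) ⊆ Iio (0 : ℝ) := fun t ht => by
      simp only [mem_Iio]; linarith [ht.2]
    have h := (hweak.mono (J := Ioo (a + 1 / 4) (b + 1 / 4)) isOpen_Ioo hsub).comp_add_right
      (a + 1 / 4) (J := Ioo 0 T) isOpen_Ioo fun t => by
        simp only [mem_Ioo, hT]
        constructor <;> intro h <;> constructor <;> linarith [h.1, h.2]
    simpa only [e] using h
  have hWdiv : ∀ τ ∈ Ioo (0 : ℝ) T, VectorCalculus.IsDivFree (W τ) := fun τ hτ =>
    isDivFree_of_ae_isWeaklyDivFree_of_smooth hWsm hWweak.ae_isWeaklyDivFree hτ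
  have horth := fun {τ : ℝ} (hτ : τ ∈ Ioo (0 : ℝ) T)
      {φ : EuclideanSpace ℝ (Fin 3) → EuclideanSpace ℝ (Fin 3)}
      (hφ : Literature.Analysis.FunctionSpaces.IsTestFunctionOn
        (⊤ : TopologicalSpace.Opens (EuclideanSpace ℝ (Fin 3))) φ)
      (hφd : VectorCalculus.IsDivFree φ) =>
    integral_inner_momentum_eq_zero_of_slab_weak hWsm hWdiv hWweak.2.2.2 hτ hφ hφd
  have hf0 : IsSmoothSpaceTimeOn (Ioo 0 T)
      (0 : ℝ → EuclideanSpace ℝ (Fin 3) → EuclideanSpace ℝ (Fin 3)) := contDiffOn_const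
  obtain ⟨P, hcl⟩ := exists_isClassicalNSSolutionOn_of_forall_integral_inner_eq_zero isOpen_Ioo
    hWsm hf0 hWdiv (fun τ hτ φ hφ hφd => horth hτ hφ hφd)
  -- shift back to `(a, b)`
  have hback := hcl.comp_add_right (-a)
  have hset : ((· + -a) ⁻¹' Ioo (0 : ℝ) T) = Ioo a b := by
    ext t
    simp only [mem_preimage, mem_Ioo, hT]
    constructor <;> intro h <;> constructor <;> linarith [h.1, h.2]
  rw [hset] at hback
  refine ⟨fun t => P (t + -a), ?_⟩
  have hback' : IsClassicalNSSolutionOn (Ioo a b) 1 0 (fun t => W (t + -a)) fun t => P (t + -a) :=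
    hback
  refine hback'.congr_velocity fun t ht => ?_
  funext x
  have ht' : t ≤ -(1 / 4 : ℝ) := by linarith [ht.2]
  simp only [hW]
  rw [show t + -a + a = t by ring]
  exact (h4 t ht' x).symm

/-! ### Step 4: scaling–rotation covariance transports the classical structure -/

/-- **Rescaled windows.** If the RSS ansatz field `w = pvAnsatz α₀ U` of a time-independent
profile is a classical solution (`ν = 1`, `f = 0`) on an open time set `S` with some pressure,
then for every `μ > 0` it is a classical solution on `(μ² ·)⁻¹' S` with some pressure: the
Navier–Stokes scaling–rotation covariance (`IsClassicalNSSolutionOn.conj_linearIsometryEquiv`,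
`.nsRescale_holds`) maps `(w, q)` to a solution on the rescaled set whose velocity is
`μ R(θ) w(μ²t, μ R(−θ) x)`, `θ = 2α₀ log μ`, which IS `w` by the exact invariance of the ansatz
(`PineauVicol2026.pvAnsatz_rss_eq_smul_rotZ`, the definition of RSS on p. 3 of the source). [cite: PineauVicol2026, §1.2 p. 3 and Remark 1.5; footnote 13] -/
theorem rssCompact_rescaled_classical {α₀ : ℝ}
    {U : EuclideanSpace ℝ (Fin 3) → EuclideanSpace ℝ (Fin 3)} {S : Set ℝ} (hS : IsOpen S)
    {q : ℝ → EuclideanSpace ℝ (Fin 3) → ℝ}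
    (h : IsClassicalNSSolutionOn S 1 0 (pvAnsatz α₀ (fun y _ => U y)) q) {μ : ℝ} (hμ : 0 < μ) :
    ∃ q' : ℝ → EuclideanSpace ℝ (Fin 3) → ℝ,
      IsClassicalNSSolutionOn ((fun t => μ ^ 2 * t) ⁻¹' S) 1 0 (pvAnsatz α₀ (fun y _ => U y)) q' := by
  set θ : ℝ := α₀ * (2 * Real.log μ) with hθ
  set R : EuclideanSpace ℝ (Fin 3) ≃ₗᵢ[ℝ] EuclideanSpace ℝ (Fin 3) := rotZLIE θ with hR
  set w : ℝ → EuclideanSpace ℝ (Fin 3) → EuclideanSpace ℝ (Fin 3) :=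
    pvAnsatz α₀ (fun y _ => U y) with hw
  have h1 := h.conj_linearIsometryEquiv (R := R) hS.uniqueDiffOn
  have h2 := IsClassicalNSSolutionOn.nsRescale_holds h1 hμ
  have hf : nsRescaleForce μ (fun t x => R ((0 : ℝ → EuclideanSpace ℝ (Fin 3) →
      EuclideanSpace ℝ (Fin 3)) t (R.symm x))) = 0 := by
    funext t x; simp [nsRescaleForce_apply]
  have hvel : nsRescale μ (fun t x => R (w t (R.symm x))) = w := by
    funext t x
    rw [nsRescale_apply]
    simp only [hR, rotZLIE_apply, rotZLIE_symm_apply]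
    rw [show rotZ (-θ) (μ • x) = μ • rotZ (-θ) x by rw [← rotZL_apply, map_smul, rotZL_apply],
      hw, hθ]
    exact (pvAnsatz_rss_eq_smul_rotZ α₀ U hμ t x).symm
  rw [hf, hvel] at h2
  exact ⟨_, h2⟩

/-! ### The registered sub-goal -/

/-- **The RSS-symmetric Type-I compactness limit is a classical Pineau–Vicol-class solution
(registered sub-goal `rssCompact_limit_classical`).** Let `v` be continuous on
`(−∞, −1/4] × ℝ³` (indeed on `ℝ × ℝ³`), obey `‖v(t,x)‖ ≤ C₀/(‖x‖ + √−t)` for `t ≤ −1/4`, let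
`t ↦ v(t − 1/4)` be a bounded weak Navier–Stokes solution on `(−∞, 0)`, and let `v` be
RSS-symmetric with speed `α₀` (`v(t,x) = μ R(2α₀ log μ) v(μ²t, μR(−2α₀ log μ)x)` for all `μ ≥ 1`,
`t ≤ −1/4`). Then the profile `U₀ = v(−1)` is `C^∞`; its ansatz field `w = pvAnsatz α₀ U₀` is a
classical solution on `(−∞, 0)` for some pressure; `w` obeys the Type-I bound with the same
constant `C₀` on all of `t < 0`; and `v = w` on `t ≤ −1/4`. (So a non-trivial such `v`
contradicts the RSS Liouville property at `(C₀, α₀)`.) [cite: ChaeWolf2017RemovingDSS, §3 (end of the proof of Thm. 1.3); PineauVicol2026, Remark 1.2, footnote 13] -/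
theorem rssCompact_limit_classical :
    ∀ (C₀ α₀ : ℝ) (v : ℝ → EuclideanSpace ℝ (Fin 3) → EuclideanSpace ℝ (Fin 3)),
      Continuous (uncurry v) →
      (∀ t ≤ -(1 / 4 : ℝ), ∀ x, ‖v t x‖ ≤ C₀ / (‖x‖ + √(-t))) →
      Literature.Analysis.FluidPDE.IsBoundedWeakNSSolutionOn (Iio 0) isOpen_Iio 1 (fun t => v (t - 1 / 4)) →
      (∀ μ : ℝ, 1 ≤ μ → ∀ t ≤ -(1 / 4 : ℝ), ∀ x,
        v t x = μ • Literature.Analysis.FluidPDE.rotZ (α₀ * (2 * Real.log μ))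
          (v (μ ^ 2 * t) (μ • Literature.Analysis.FluidPDE.rotZ (-(α₀ * (2 * Real.log μ))) x))) →
      ContDiff ℝ (⊤ : ℕ∞) (v (-1)) ∧
      (∃ P : ℝ → EuclideanSpace ℝ (Fin 3) → ℝ,
        Literature.Analysis.FluidPDE.IsClassicalNSSolutionOn (Iio 0) 1 0
          (Literature.Analysis.FluidPDE.pvAnsatz α₀ (fun y _ => v (-1) y)) P) ∧
      Literature.Analysis.FluidPDE.HasTypeIDecay C₀
        (Literature.Analysis.FluidPDE.pvAnsatz α₀ (fun y _ => v (-1) y)) ∧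
      (∀ t ≤ -(1 / 4 : ℝ), ∀ x, v t x = Literature.Analysis.FluidPDE.pvAnsatz α₀ (fun y _ => v (-1) y) t x) := by
  intro C₀ α₀ v hvc hvI hweak hss
  have hprof : ContDiff ℝ ∞ (v (-1)) := rssCompact_profile_contDiff hvc hvI hweak hss
  have h4 := rssCompact_eq_pvAnsatz_of_symmetric α₀ v hss
  set w : ℝ → EuclideanSpace ℝ (Fin 3) → EuclideanSpace ℝ (Fin 3) :=
    pvAnsatz α₀ (fun y _ => v (-1) y) with hw
  have hwsm : ContDiffOn ℝ ∞ (uncurry w) (Iio (0 : ℝ) ×ˢ (univ : Set (EuclideanSpace ℝ (Fin 3)))) :=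
    rssCompact_contDiffOn_pvAnsatz α₀ (v (-1)) hprof
  refine ⟨hprof, ?_, ?_, h4⟩
  · -- Step 3: windows `(−n − 5, −1/4)` patched to `(−∞, −1/4)`
    have hwin : ∀ n : ℕ, ∃ q : ℝ → EuclideanSpace ℝ (Fin 3) → ℝ,
        IsClassicalNSSolutionOn (Ioo (-(n : ℝ) - 5) (-(1 / 4))) 1 0 w q := fun n =>
      rssCompact_window_classical hwsm h4 hweak (by
        have : (0 : ℝ) ≤ n := n.cast_nonneg
        linarith) le_rfl
    choose q hq using hwin
    obtain ⟨P₁, hP₁⟩ := rssCompact_exists_pressure_of_cover 1 0 w (Iio (-(1 / 4))) (fun n => Ioo (-(n : ℝ) - 5) (-(1 / 4)))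
      q isOpen_Iio (fun _ => isOpen_Ioo) (fun t ht => by
        obtain ⟨n, hn⟩ := exists_nat_gt (-t - 5)
        exact ⟨n, ⟨by linarith, ht⟩⟩) hq
    -- Step 4: rescaled copies `(−∞, −4^{-k}/4)` patched to `(−∞, 0)`
    have hres : ∀ k : ℕ, ∃ q' : ℝ → EuclideanSpace ℝ (Fin 3) → ℝ,
        IsClassicalNSSolutionOn ((fun t => ((2 : ℝ) ^ k) ^ 2 * t) ⁻¹' Iio (-(1 / 4))) 1 0 w q' :=
      fun k => rssCompact_rescaled_classical isOpen_Iio hP₁ (by positivity)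
    choose q' hq' using hres
    refine rssCompact_exists_pressure_of_cover 1 0 w (Iio 0)
      (fun k => (fun t => ((2 : ℝ) ^ k) ^ 2 * t) ⁻¹' Iio (-(1 / 4))) q' isOpen_Iio
      (fun k => isOpen_Iio.preimage (continuous_const.mul continuous_id)) (fun t ht => ?_) hq'
    -- coverage: for `t < 0` some `4^k (−t) > 1/4`
    have ht' : 0 < -t := by simpa using ht
    obtain ⟨k, hk⟩ := pow_unbounded_of_one_lt (1 / -t) (by norm_num : (1 : ℝ) < 4)
    refine ⟨k, ?_⟩
    simp only [mem_preimage, mem_Iio]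
    have e4 : ((2 : ℝ) ^ k) ^ 2 = 4 ^ k := by
      rw [← pow_mul, mul_comm, pow_mul]; norm_num
    rw [e4]
    have h1 : 1 < 4 ^ k * (-t) := by
      have := (div_lt_iff₀ ht').1 hk
      linarith
    nlinarith
  · -- the Type-I bound of the ansatz field with the same constant (Remark 1.2)
    have hU : ∀ y : EuclideanSpace ℝ (Fin 3), ‖v (-1) y‖ ≤ C₀ / (‖y‖ + 1) := fun y => by
      have h := hvI (-1) (by norm_num) y
      rwa [neg_neg, Real.sqrt_one] at h
    intro t ht x
    exact norm_pvAnsatz_le_of_profile hU ht x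

end Summit.NavierStokesRegularity.NavierStokesRegularity.Theorems

end
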